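import Summits.Schanuel.Schanuel.Theorems.ZilberEacGraphNewtonBranch
import Mathlib.FieldTheory.IsAlgClosed.Basic
import HarnessLib

/-!
# The equimodular class, LI: a SIMPLE ROOT of the lowest (or highest) row suffices — the
# `(1, k)` Newton–Puiseux step

HONEST FRAMING.  Cell `pub-schanuel` (Zilber's Exponential-Algebraic Closedness, case ladder;
host summit Schanuel), seat 2, gen 25.  **`unprojectedDense_graph_simpleZero`** /
**`unprojectedDense_graph_simplePole`**: let `p ∈ ℂ[X]` have degree `≥ 2` and let
`P(x₀, y₀) = Q(x₀)(y₀) = Σ_j q_j(x₀) y₀^j` be irreducible with rows of degree `≤ N` and a SIMPLE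
NONZERO root of the top row.  If `q₀` has a SIMPLE root `a` (or `q₀ ≠ 0` and `q_r` has a simple
root, `r = deg_t Q`), then `{x₁ = p(x₀), P = 0}` has Zariski-dense exponential points.  Mechanism
(**`exists_newtonDatum_simpleZero`**, stated for any `Q` whose rows do not all vanish at `a`): with
`k ≥ 1` the least index with `q_k(a) ≠ 0` (it exists by irreducibility), the substitution `x₀ = a + t^k`, `y₀ = t·w` gives
`Q(a + t^k)(t w) = t^k·Q̃(t)(w)` with `Q̃(0)(w) = s₀(a) + q_k(a) w^k`, `s₀ = q₀/(X - a)`,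
`s₀(a) = q₀'(a) ≠ 0` — `k` simple nonzero roots; file L concludes.  In particular
(**`unprojectedDense_graph_reciprocal_simpleRoot`**) EVERY irreducible reciprocal-type fibre
(`q₀ = c·q_r`) of ANY `y₀`-degree with a simple nonzero top-row root and a simple root of `q_r` is
dense — e.g. **`{x₁ = p(x₀), x₀y₀⁵ + y₀² + x₀ = 0}`** (zero and pole over `x₀ = 0` ramified of orders
`2` and `3`).  Complete classes of instances of an OPEN question (Mantova–Masser, PLMS 2024 §1 p. 5);
EC(3,2) OPEN; NOT Schanuel's conjecture (neither used nor implied; EAC ⇏ SC).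
-/

noncomputable section

open Filter Topology Set Complex MvPolynomial
open Literature.NumberTheory.Transcendental Literature.ModelTheory.Zilber
open Literature.ModelTheory.ExponentialFields

set_option linter.dupNamespace false

namespace Summit.Schanuel.Schanuel.Theorems

/-! ## Part A. The `(1, k)` Newton datum at a simple root of `q₀` -/

/-- **The Newton–Puiseux datum at a simple root of the lowest row.**  See the module docstring.
[folklore] -/
theorem exists_newtonDatum_simpleZero (Q : Polynomial (Polynomial ℂ)) {a : ℂ}
    (hex₀ : ∃ j, ¬ (Q.coeff j).IsRoot a) (ha : (Q.coeff 0).IsRoot a)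
    (ha' : ¬ (Polynomial.derivative (Q.coeff 0)).IsRoot a) :
    ∃ (k : ℕ) (Qt : Polynomial (Polynomial ℂ)) (w₀ : ℂ), 1 ≤ k ∧ w₀ ≠ 0 ∧
      (Qt.map (Polynomial.evalRingHom 0)).IsRoot w₀ ∧
      ¬ ((Polynomial.derivative Qt).map (Polynomial.evalRingHom 0)).IsRoot w₀ ∧
      (∀ t w : ℂ, t ≠ 0 → w ≠ 0 →
        (Q.map (Polynomial.evalRingHom (a + t ^ k))).eval (t ^ 1 * w) =
          t ^ k * (Qt.map (Polynomial.evalRingHom t)).eval w) ∧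
      (∀ j, 1 ≤ j → j < k → (Q.coeff j).IsRoot a) ∧ ¬ (Q.coeff k).IsRoot a := by
  classical
  -- the first index `k ≥ 1` with `q_k(a) ≠ 0`
  have hex : ∃ j, 1 ≤ j ∧ ¬ (Q.coeff j).IsRoot a := by
    obtain ⟨j, hj⟩ := hex₀
    refine ⟨j, ?_, hj⟩
    by_contra h
    have : j = 0 := by omega
    subst this
    exact hj ha
  set k := Nat.find hex with hkdef
  obtain ⟨hk1, hk⟩ : 1 ≤ k ∧ ¬ (Q.coeff k).IsRoot a := Nat.find_spec hex
  have hmin : ∀ j, 1 ≤ j → j < k → (Q.coeff j).IsRoot a := fun j hj hjk => by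
    by_contra h
    exact Nat.find_min hex hjk ⟨hj, h⟩
  have hkr : k ≤ Q.natDegree := by
    by_contra h
    apply hk
    rw [Polynomial.coeff_eq_zero_of_natDegree_lt (by omega)]
    exact Polynomial.IsRoot.def.2 (Polynomial.eval_zero)
  -- factorisations `q_j = (X - a) s_j` for the rows vanishing at `a`
  set s : ℕ → Polynomial ℂ := fun j => (Q.coeff j) /ₘ (Polynomial.X - Polynomial.C a) with hs
  have hfac : ∀ j, (Q.coeff j).IsRoot a → Q.coeff j = (Polynomial.X - Polynomial.C a) * s j := fun j hj =>
    (Polynomial.mul_divByMonic_eq_iff_isRoot.2 hj).symm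
  have hs0 : (s 0).eval a ≠ 0 := by
    intro h
    apply ha'
    have e := hfac 0 ha
    rw [Polynomial.IsRoot, e, Polynomial.derivative_mul]
    simp [h]
  -- the polynomial `Q̃`
  set c : ℕ → Polynomial ℂ := fun j =>
    if j = 0 then (s 0).comp (Polynomial.C a + Polynomial.X ^ k)
    else if j < k then Polynomial.X ^ j * (s j).comp (Polynomial.C a + Polynomial.X ^ k)
    else Polynomial.X ^ (j - k) * (Q.coeff j).comp (Polynomial.C a + Polynomial.X ^ k) with hc
  set Qt : Polynomial (Polynomial ℂ) :=
    ∑ j ∈ Finset.range (Q.natDegree + 1), Polynomial.monomial j (c j) with hQt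
  have hcoefQt : ∀ j, Qt.coeff j = if j < Q.natDegree + 1 then c j else 0 := by
    intro j
    rw [hQt, Polynomial.finsetSum_coeff]
    simp only [Polynomial.coeff_monomial, Finset.sum_ite_eq', Finset.mem_range]
  have hQtdeg : Qt.natDegree < Q.natDegree + 1 := by
    refine Nat.lt_succ_of_le (Polynomial.natDegree_sum_le_of_forall_le _ _ fun j hj => ?_)
    exact (Polynomial.natDegree_monomial_le _).trans (Nat.lt_succ_iff.1 (Finset.mem_range.1 hj))
  -- values of the coefficients at `t = 0`
  have hc0 : ∀ j, (c j).eval 0 = if j = 0 then (s 0).eval a else if j = k then (Q.coeff k).eval a else 0 := by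
    intro j
    simp only [hc]
    by_cases h0 : j = 0
    · subst h0
      simp [zero_pow (Nat.pos_iff_ne_zero.1 hk1)]
    · rw [if_neg h0, if_neg h0]
      by_cases hjk : j < k
      · rw [if_pos hjk, if_neg (by omega)]
        simp [zero_pow h0]
      · rw [if_neg hjk]
        by_cases hjk' : j = k
        · subst hjk'
          simp [zero_pow (Nat.pos_iff_ne_zero.1 hk1)]
        · rw [if_neg hjk']
          simp [zero_pow (show j - k ≠ 0 by omega)]
  have hQt0 : ∀ w : ℂ, (Qt.map (Polynomial.evalRingHom 0)).eval w =
      (s 0).eval a + (Q.coeff k).eval a * w ^ k := by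
    intro w
    rw [evalPP_eq_sum Qt 0 w hQtdeg]
    have key : ∀ j ∈ Finset.range (Q.natDegree + 1), (Qt.coeff j).eval 0 * w ^ j =
        (if j = 0 then (s 0).eval a else 0) + (if j = k then (Q.coeff k).eval a * w ^ k else 0) := by
      intro j hj
      rw [hcoefQt, if_pos (Finset.mem_range.1 hj), hc0]
      by_cases h0 : j = 0
      · subst h0; rw [if_pos rfl, if_pos rfl, if_neg (by omega)]; simp
      · rw [if_neg h0, if_neg h0]
        by_cases hjk : j = k
        · subst hjk; simp
        · rw [if_neg hjk, if_neg hjk]; simp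
    rw [Finset.sum_congr rfl key, Finset.sum_add_distrib, Finset.sum_ite_eq', Finset.sum_ite_eq']
    simp only [Finset.mem_range, Nat.zero_lt_succ, if_true]
    rw [if_pos (by omega)]
  have hQt'0 : ∀ w : ℂ, ((Polynomial.derivative Qt).map (Polynomial.evalRingHom 0)).eval w =
      (k : ℂ) * (Q.coeff k).eval a * w ^ (k - 1) := by
    intro w
    have hdeg' : (Polynomial.derivative Qt).natDegree < Q.natDegree + 1 :=
      lt_of_le_of_lt (Polynomial.natDegree_derivative_le Qt) (lt_of_le_of_lt (Nat.sub_le _ _) hQtdeg)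
    rw [evalPP_eq_sum _ 0 w hdeg']
    have key : ∀ j ∈ Finset.range (Q.natDegree + 1),
        ((Polynomial.derivative Qt).coeff j).eval 0 * w ^ j =
          if j = k - 1 then (k : ℂ) * (Q.coeff k).eval a * w ^ (k - 1) else 0 := by
      intro j hj
      rw [Polynomial.coeff_derivative, Polynomial.eval_mul, hcoefQt]
      by_cases hj1 : j + 1 < Q.natDegree + 1
      · rw [if_pos hj1, hc0, if_neg (Nat.succ_ne_zero j)]
        by_cases hjk : j + 1 = k
        · rw [if_pos hjk, if_pos (by omega)]
          have : ((j : Polynomial ℂ) + 1).eval (0 : ℂ) = (k : ℂ) := by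
            rw [Polynomial.eval_add, Polynomial.eval_natCast, Polynomial.eval_one]; exact_mod_cast hjk
          rw [this, show k - 1 = j by omega]; ring
        · rw [if_neg hjk, if_neg (by omega)]; simp
      · rw [if_neg hj1, if_neg (by omega)]; simp
    rw [Finset.sum_congr rfl key, Finset.sum_ite_eq']
    rw [if_pos (Finset.mem_range.2 (by omega))]
  -- the root `w₀` with `w₀^k = -s₀(a)/q_k(a)`
  have hqk : (Q.coeff k).eval a ≠ 0 := hk
  obtain ⟨w₀, hw₀k⟩ := IsAlgClosed.exists_pow_nat_eq (-(s 0).eval a / (Q.coeff k).eval a) hk1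
  have hw₀ : w₀ ≠ 0 := by
    rintro rfl
    rw [zero_pow (Nat.pos_iff_ne_zero.1 hk1)] at hw₀k
    exact div_ne_zero (neg_ne_zero.2 hs0) hqk hw₀k.symm
  refine ⟨k, Qt, w₀, hk1, hw₀, ?_, ?_, fun t w ht hw => ?_, hmin, hk⟩
  · rw [Polynomial.IsRoot, hQt0, hw₀k]
    field_simp
    ring
  · rw [Polynomial.IsRoot, hQt'0]
    exact mul_ne_zero (mul_ne_zero (Nat.cast_ne_zero.2 (by omega)) hqk) (pow_ne_zero _ hw₀)
  · -- the identity `Q(a + t^k)(t w) = t^k Q̃(t)(w)`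
    rw [evalPP_eq_sum Q _ _ (Nat.lt_succ_self _), evalPP_eq_sum Qt t w hQtdeg, Finset.mul_sum]
    refine Finset.sum_congr rfl fun j hj => ?_
    rw [hcoefQt, if_pos (Finset.mem_range.1 hj), pow_one]
    simp only [hc]
    by_cases h0 : j = 0
    · subst h0
      rw [if_pos rfl, hfac 0 ha]
      simp [Polynomial.eval_comp]
    · rw [if_neg h0]
      by_cases hjk : j < k
      · rw [if_pos hjk, hfac j (hmin j (by omega) hjk)]
        simp [Polynomial.eval_comp]
        ring
      · rw [if_neg hjk]
        have hpow : t ^ j = t ^ k * t ^ (j - k) := by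
          rw [← pow_add, Nat.add_sub_cancel' (by omega)]
        simp [Polynomial.eval_comp, mul_pow, hpow]
        ring

/-! ## Part B. Surface theorems -/

/-- **A simple root of the lowest row suffices.**  See the module docstring.
[cite: MantovaMasser2023, §1 Further remarks, p. 5 (the question, open in general)] (new) -/
theorem unprojectedDense_graph_simpleZero (Q : Polynomial (Polynomial ℂ))
    {P : MvPolynomial (Fin 2) ℂ}
    (hP : ∀ x y : ℂ, MvPolynomial.eval ![x, y] P = (Q.map (Polynomial.evalRingHom x)).eval y)
    (hirr : Irreducible P) (N : ℕ) (hN : ∀ j, (Q.coeff j).natDegree ≤ N) (T : Polynomial ℂ)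
    (hT : ∀ j, T.coeff j = (Q.coeff j).coeff N) (hT0 : T ≠ 0) {θ : ℂ} (hθ0 : θ ≠ 0)
    (hTθ : T.IsRoot θ) (hT'θ : (Polynomial.derivative T).eval θ ≠ 0)
    {a : ℂ} (ha : (Q.coeff 0).IsRoot a) (ha' : ¬ (Polynomial.derivative (Q.coeff 0)).IsRoot a)
    (p : Polynomial ℂ) (hd : 2 ≤ p.natDegree) :
    UnprojectedDense {w : Fin 2 ⊕ Fin 2 → ℂ | w (Sum.inl 1) = p.eval (w (Sum.inl 0)) ∧
      MvPolynomial.eval ![w (Sum.inl 0), w (Sum.inr 0)] P = 0} := by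
  have hQirr : Irreducible Q := (irreducible_rows_iff hP).1 hirr
  have hQ1 : Q.natDegree ≠ 0 := fun h =>
    natDegree_ne_zero_of_isRoot hT0 hTθ (Nat.le_zero.1 (h ▸ natDegree_topRow_le Q N T hT))
  obtain ⟨k, Qt, w₀, hk1, hw₀, hroot, hsimple, hid, -, -⟩ :=
    exists_newtonDatum_simpleZero Q (exists_coeff_not_isRoot_of_irreducible hQirr hQ1 a) ha ha'
  exact unprojectedDense_graph_newtonBranch Q hP hirr N hN T hT hT0 hθ0 hTθ hT'θ a (ν := k) hk1 le_rfl Qt hw₀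
    hroot hsimple (Or.inl hid) p hd

/-- **A simple root of the highest row suffices** (`q₀ ≠ 0`).  See the module docstring.
[cite: MantovaMasser2023, §1 Further remarks, p. 5 (the question, open in general)] (new) -/
theorem unprojectedDense_graph_simplePole (Q : Polynomial (Polynomial ℂ))
    {P : MvPolynomial (Fin 2) ℂ}
    (hP : ∀ x y : ℂ, MvPolynomial.eval ![x, y] P = (Q.map (Polynomial.evalRingHom x)).eval y)
    (hirr : Irreducible P) (N : ℕ) (hN : ∀ j, (Q.coeff j).natDegree ≤ N) (T : Polynomial ℂ)
    (hT : ∀ j, T.coeff j = (Q.coeff j).coeff N) (hT0 : T ≠ 0) {θ : ℂ} (hθ0 : θ ≠ 0)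
    (hTθ : T.IsRoot θ) (hT'θ : (Polynomial.derivative T).eval θ ≠ 0) (hQ00 : Q.coeff 0 ≠ 0)
    {a : ℂ} (ha : (Q.coeff Q.natDegree).IsRoot a)
    (ha' : ¬ (Polynomial.derivative (Q.coeff Q.natDegree)).IsRoot a)
    (p : Polynomial ℂ) (hd : 2 ≤ p.natDegree) :
    UnprojectedDense {w : Fin 2 ⊕ Fin 2 → ℂ | w (Sum.inl 1) = p.eval (w (Sum.inl 0)) ∧
      MvPolynomial.eval ![w (Sum.inl 0), w (Sum.inr 0)] P = 0} := by
  classical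
  have hQirr : Irreducible Q := (irreducible_rows_iff hP).1 hirr
  have hQ1 : Q.natDegree ≠ 0 := fun h =>
    natDegree_ne_zero_of_isRoot hT0 hTθ (Nat.le_zero.1 (h ▸ natDegree_topRow_le Q N T hT))
  have hN' : Q.reverse.natDegree = Q.natDegree := by
    rw [Polynomial.reverse_natDegree, Polynomial.natTrailingDegree_eq_zero_of_constantCoeff_ne_zero hQ00,
      Nat.sub_zero]
  have hirr' : Irreducible Q.reverse := irreducible_reverse hQirr hQ00
  have h0' : (Q.reverse.coeff 0).IsRoot a := by rw [Polynomial.coeff_zero_reverse]; exact ha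
  have h0'' : ¬ (Polynomial.derivative (Q.reverse.coeff 0)).IsRoot a := by
    rw [Polynomial.coeff_zero_reverse]; exact ha'
  obtain ⟨k, Qt, w₀, hk1, hw₀, hroot, hsimple, hid, -, -⟩ :=
    exists_newtonDatum_simpleZero Q.reverse
      (exists_coeff_not_isRoot_of_irreducible hirr' (by rw [hN']; exact hQ1) a) h0' h0''
  refine unprojectedDense_graph_newtonBranch Q hP hirr N hN T hT hT0 hθ0 hTθ hT'θ a (ν := k) hk1 le_rfl Qt hw₀
    hroot hsimple (Or.inr ⟨hQ00, fun t w ht hw => ?_⟩) p hd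
  -- the pole identity from the reversed one
  have hx0 : t ^ 1 * w ≠ 0 := mul_ne_zero (pow_ne_zero _ ht) hw
  haveI := invertibleOfNonzero (inv_ne_zero hx0)
  have h := Polynomial.eval₂_reverse_mul_pow (Polynomial.evalRingHom (a + t ^ k)) (t ^ 1 * w)⁻¹ Q
  rw [invOf_eq_inv, inv_inv] at h
  have hid1 := hid t w ht hw
  rw [Polynomial.eval_map] at hid1
  rw [Polynomial.eval_map, ← hid1, ← h, inv_pow]
  field_simp

/-- **Every irreducible reciprocal-type fibre, of any `y₀`-degree, with a simple nonzero top-row root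
and a simple root of `q_r` is dense over polynomial graphs of degree `≥ 2`.**
[cite: MantovaMasser2023, §1 Further remarks, p. 5 (the question, open in general)] (new) -/
theorem unprojectedDense_graph_reciprocal_simpleRoot (Q : Polynomial (Polynomial ℂ))
    {P : MvPolynomial (Fin 2) ℂ}
    (hP : ∀ x y : ℂ, MvPolynomial.eval ![x, y] P = (Q.map (Polynomial.evalRingHom x)).eval y)
    (hirr : Irreducible P) (N : ℕ) (hN : ∀ j, (Q.coeff j).natDegree ≤ N) (T : Polynomial ℂ)
    (hT : ∀ j, T.coeff j = (Q.coeff j).coeff N) (hT0 : T ≠ 0) {θ : ℂ} (hθ0 : θ ≠ 0)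
    (hTθ : T.IsRoot θ) (hT'θ : (Polynomial.derivative T).eval θ ≠ 0) {c : ℂ} (hc : c ≠ 0)
    (hrec : Q.coeff 0 = Polynomial.C c * Q.coeff Q.natDegree) {a : ℂ}
    (ha : (Q.coeff Q.natDegree).IsRoot a) (ha' : ¬ (Polynomial.derivative (Q.coeff Q.natDegree)).IsRoot a)
    (p : Polynomial ℂ) (hd : 2 ≤ p.natDegree) :
    UnprojectedDense {w : Fin 2 ⊕ Fin 2 → ℂ | w (Sum.inl 1) = p.eval (w (Sum.inl 0)) ∧
      MvPolynomial.eval ![w (Sum.inl 0), w (Sum.inr 0)] P = 0} := by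
  refine unprojectedDense_graph_simpleZero Q hP hirr N hN T hT hT0 hθ0 hTθ hT'θ (a := a) ?_ ?_ p hd
  · rw [hrec, Polynomial.IsRoot, Polynomial.eval_mul, Polynomial.eval_C, ha.eq_zero, mul_zero]
  · rw [hrec, Polynomial.derivative_mul, Polynomial.derivative_C, zero_mul, zero_add, Polynomial.IsRoot,
      Polynomial.eval_mul, Polynomial.eval_C]
    exact mul_ne_zero hc ha'

/-! ## Part C. Example: a reciprocal quintic -/

/-- `x₀y₀⁵ + y₀² + x₀` is irreducible. -/
theorem irreducible_quinticReciprocalFibre :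
    Irreducible (X 0 * X 1 ^ 5 + X 1 ^ 2 + X 0 : MvPolynomial (Fin 2) ℂ) := by
  have himage : MvPolynomial.finSuccEquiv ℂ 1 (X 0 * X 1 ^ 5 + X 1 ^ 2 + X 0) =
      Polynomial.C (X 0 ^ 5 + 1 : MvPolynomial (Fin 1) ℂ) * Polynomial.X +
        Polynomial.C (X 0 ^ 2 : MvPolynomial (Fin 1) ℂ) := by
    rw [show (X 1 : MvPolynomial (Fin 2) ℂ) = X (Fin.succ 0) from rfl]
    simp only [map_add, map_mul, map_pow, map_one, MvPolynomial.finSuccEquiv_X_zero,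
      MvPolynomial.finSuccEquiv_X_succ]
    ring
  have ha : (X 0 ^ 5 + 1 : MvPolynomial (Fin 1) ℂ) ≠ 0 := by
    intro h
    have := congrArg (MvPolynomial.eval fun _ => (0 : ℂ)) h
    simp at this
  have hcop : IsCoprime (X 0 ^ 5 + 1 : MvPolynomial (Fin 1) ℂ) (X 0 ^ 2) := ⟨1, -X 0 ^ 3, by ring⟩
  have hirr := irreducible_C_mul_X_add_C_of_isCoprime ha hcop
  rw [← himage] at hirr
  exact (MulEquiv.irreducible_iff (MvPolynomial.finSuccEquiv ℂ 1).toMulEquiv).1 hirr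

/-- **`{x₁ = p(x₀), x₀y₀⁵ + y₀² + x₀ = 0}` — a reciprocal QUINTIC fibre whose zero and pole over
`x₀ = 0` are ramified (of orders `2` and `3`) — is in Mantova–Masser's case and DENSE** for every
`p` of degree `≥ 2` (top row `X⁵ + 1`, `θ = -1`; simple root `0` of `q₀ = q₅ = x₀`).
[cite: MantovaMasser2023, §1 Further remarks, p. 5 (the question, open in general)] (new) -/
theorem unprojectedDensityQuestion_graph_quinticReciprocalFibre (p : Polynomial ℂ) (hd : 2 ≤ p.natDegree) :
    MMCaseDimPiOneFree {w : Fin 2 ⊕ Fin 2 → ℂ | w (Sum.inl 1) = p.eval (w (Sum.inl 0)) ∧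
      w (Sum.inl 0) * w (Sum.inr 0) ^ 5 + w (Sum.inr 0) ^ 2 + w (Sum.inl 0) = 0} ∧
    UnprojectedDense {w : Fin 2 ⊕ Fin 2 → ℂ | w (Sum.inl 1) = p.eval (w (Sum.inl 0)) ∧
      w (Sum.inl 0) * w (Sum.inr 0) ^ 5 + w (Sum.inr 0) ^ 2 + w (Sum.inl 0) = 0} := by
  classical
  set P : MvPolynomial (Fin 2) ℂ := X 0 * X 1 ^ 5 + X 1 ^ 2 + X 0 with hPdef
  have hset : {w : Fin 2 ⊕ Fin 2 → ℂ | w (Sum.inl 1) = p.eval (w (Sum.inl 0)) ∧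
      w (Sum.inl 0) * w (Sum.inr 0) ^ 5 + w (Sum.inr 0) ^ 2 + w (Sum.inl 0) = 0} =
      {w : Fin 2 ⊕ Fin 2 → ℂ | w (Sum.inl 1) = p.eval (w (Sum.inl 0)) ∧
        MvPolynomial.eval ![w (Sum.inl 0), w (Sum.inr 0)] P = 0} := by
    ext w
    simp only [Set.mem_setOf_eq, hPdef, MvPolynomial.eval_X, map_add, map_mul, map_pow,
      Matrix.cons_val_zero, Matrix.cons_val_one]
  rw [hset]
  have hirr : Irreducible P := irreducible_quinticReciprocalFibre
  -- the rows
  set Q : Polynomial (Polynomial ℂ) := Polynomial.C Polynomial.X * Polynomial.X ^ 5 + Polynomial.X ^ 2 +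
    Polynomial.C Polynomial.X with hQ
  have hP : ∀ x y : ℂ, MvPolynomial.eval ![x, y] P = (Q.map (Polynomial.evalRingHom x)).eval y := by
    intro x y
    simp [hPdef, hQ]
  have hcoefQ : ∀ j, Q.coeff j = if j = 5 then Polynomial.X else if j = 2 then 1
      else if j = 0 then Polynomial.X else 0 := by
    intro j
    simp only [hQ, Polynomial.coeff_add, Polynomial.coeff_C_mul, Polynomial.coeff_X_pow, Polynomial.coeff_C]
    rcases j with _ | _ | _ | _ | _ | _ | j <;> simp
  have hQdeg : Q.natDegree = 5 := by
    refine le_antisymm ?_ (Polynomial.le_natDegree_of_ne_zero (by rw [hcoefQ]; simp))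
    rw [Polynomial.natDegree_le_iff_coeff_eq_zero]
    intro j hj
    rw [hcoefQ, if_neg (by omega), if_neg (by omega), if_neg (by omega)]
  set T : Polynomial ℂ := Polynomial.X ^ 5 + 1 with hTdef
  have hT : ∀ j, T.coeff j = (Q.coeff j).coeff 1 := by
    intro j
    rw [hcoefQ, hTdef, Polynomial.coeff_add, Polynomial.coeff_X_pow, Polynomial.coeff_one]
    rcases j with _ | _ | _ | _ | _ | _ | j <;> simp [Polynomial.coeff_one]
  refine ⟨mmCase_fibreCurveSurface p hd hirr ?_, ?_⟩
  · -- every `t ≠ 0` has a nonzero fibre point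
    refine (Set.finite_singleton (0 : ℂ)).infinite_compl.mono ?_
    intro t ht
    simp only [Set.mem_compl_iff, Set.mem_singleton_iff] at ht
    set q : Polynomial ℂ := Polynomial.C t * Polynomial.X ^ 5 + (Polynomial.X ^ 2 + Polynomial.C t) with hq
    have hlow : (Polynomial.X ^ 2 + Polynomial.C t : Polynomial ℂ).degree < (Polynomial.C t * Polynomial.X ^ 5).degree := by
      rw [Polynomial.degree_C_mul_X_pow 5 ht]
      refine lt_of_le_of_lt (Polynomial.degree_add_le _ _) ?_
      rw [max_lt_iff]
      refine ⟨?_, lt_of_le_of_lt Polynomial.degree_C_le (by norm_num)⟩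
      rw [Polynomial.degree_X_pow]; norm_num
    have hqdeg : 0 < q.degree := by
      rw [hq, Polynomial.degree_add_eq_left_of_degree_lt hlow, Polynomial.degree_C_mul_X_pow 5 ht]
      norm_num
    obtain ⟨y, hy⟩ := Complex.exists_root hqdeg
    have hy' : t * y ^ 5 + y ^ 2 + t = 0 := by
      have := hy.eq_zero
      simp only [hq, Polynomial.eval_add, Polynomial.eval_mul, Polynomial.eval_C, Polynomial.eval_pow,
        Polynomial.eval_X] at this
      linear_combination this
    refine ⟨y, ?_, ?_⟩
    · rintro rfl
      apply ht
      linear_combination hy'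
    · simp only [hPdef, map_add, map_mul, map_pow, MvPolynomial.eval_X, Matrix.cons_val_zero,
        Matrix.cons_val_one]
      exact hy'
  · refine unprojectedDense_graph_reciprocal_simpleRoot Q hP hirr 1 (fun j => ?_) T hT ?_ (θ := -1)
      (by norm_num) ?_ ?_ (c := 1) one_ne_zero ?_ (a := 0) ?_ ?_ p hd
    · rw [hcoefQ]; split_ifs <;> simp
    · intro h
      have := congrArg (fun q : Polynomial ℂ => q.eval 0) h
      simp [hTdef] at this
    · simp [hTdef]; norm_num
    · simp [hTdef]; norm_num
    · rw [hQdeg, hcoefQ, hcoefQ]; simp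
    · rw [hQdeg, hcoefQ]; simp
    · rw [hQdeg, hcoefQ]; simp

end Summit.Schanuel.Schanuel.Theorems
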